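/-
Copyright: H21 programme, solo seat `solo-RiemannHypothesis-informed` (session 4).
-/
import Summits.RiemannHypothesis.RiemannHypothesis.Theorems.SoloInformedDodging
import Literature.NumberTheory.LFunctions.LargeValuesFourierDecay

/-!
# Decay of the window transform from smoothness (solo-informed, T8)

The third typed ingredient of the quantitative "dodging" programme
(`SoloInformedDodging`, `SoloInformedGroundStateDipole`): for a test `h ∈ C^n_c(ℝ)` supported in
`[-a, a]`, `n` integrations by parts give

`∫ h⁽ⁿ⁾(t) e^{ct} dt = (−c)ⁿ ∫ h(t) e^{ct} dt`,

hence the decay estimate for the `½`-symmetric Mellin–Laplace transform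
`ĥ(s) = ∫ h(t) e^{(s − ½)t} dt` (`Literature.NumberTheory.LFunctions.weilMellin`):

`‖s − ½‖ⁿ · ‖ĥ(s)‖ ≤ e^{|Re s − ½|·a} · ‖h⁽ⁿ⁾‖_{L¹}`.

On the critical line this is the Fourier decay `|F_h(τ)| ≤ ‖h⁽ⁿ⁾‖₁/|τ|ⁿ`; in the critical strip
the exponential factor is at most `e^{a/2}`.  This is what converts a zero COUNT in shells around a
height `γ₀` into a bound for the sampling energy `Σ_ρ m_ρ |ĝ(ρ)|²` of a window test
`g = h · e^{−iγ₀t}` (the hypothesis `B` of the visibility inequalities).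

Main results:
* `integral_iteratedDeriv_mul_cexp` — the `n`-fold integration by parts identity;
* `norm_integral_mul_cexp_le` — `‖∫ h e^{ct}‖ ≤ e^{|Re c| a} ∫ ‖h‖` for `tsupport h ⊆ [-a,a]`;
* `norm_weilMellin_le_of_iteratedDeriv` — the decay estimate above;
* `norm_weilMellin_le_of_isWeilTest`, `norm_weilMellin_critical_le` — the same for Weil tests,
  every `n`, and the Fourier decay `|F_h(τ)| ≤ ‖h⁽ⁿ⁾‖₁/|τ|ⁿ` on the critical line.

All statements are about `h : ℝ → ℂ`; no hypothesis on zeta is involved.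
-/

open MeasureTheory Complex Set Filter Topology Literature.NumberTheory.LFunctions
open scoped ContDiff

namespace Summit.RiemannHypothesis.RiemannHypothesis.Theorems

/-! ## `n`-fold integration by parts against an exponential -/

/-- `∫ h⁽ⁿ⁾(t) e^{ct} dt = (−c)ⁿ ∫ h(t) e^{ct} dt` for `h ∈ C^n_c(ℝ)`. -/
theorem integral_iteratedDeriv_mul_cexp (n : ℕ) {h : ℝ → ℂ} (hh : ContDiff ℝ n h)
    (hc : HasCompactSupport h) (c : ℂ) :
    ∫ t : ℝ, iteratedDeriv n h t * cexp (c * t) = (-c) ^ n * ∫ t : ℝ, h t * cexp (c * t) := by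
  induction n generalizing h with
  | zero => simp
  | succ n ih =>
    have hh' : ContDiff ℝ ((n : WithTop ℕ∞) + 1) h := by exact_mod_cast hh
    have h1 : ContDiff ℝ 1 h := hh'.of_le le_add_self
    rw [iteratedDeriv_succ', ih hh'.deriv' hc.deriv, integral_deriv_mul_cexp h1 hc c]
    ring

/-! ## The trivial bound with the support factor -/

/-- `‖∫ h(t) e^{ct} dt‖ ≤ e^{|Re c|·a} ∫ ‖h‖` for continuous `h` with `tsupport h ⊆ [-a, a]`. -/
theorem norm_integral_mul_cexp_le {h : ℝ → ℂ} (hcont : Continuous h) (hc : HasCompactSupport h)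
    {a : ℝ} (hhs : tsupport h ⊆ Icc (-a) a) (c : ℂ) :
    ‖∫ t : ℝ, h t * cexp (c * t)‖ ≤ Real.exp (|c.re| * a) * ∫ t : ℝ, ‖h t‖ := by
  have hpt : ∀ t : ℝ, ‖h t * cexp (c * t)‖ ≤ Real.exp (|c.re| * a) * ‖h t‖ := by
    intro t
    by_cases ht : h t = 0
    · simp [ht]
    · have htI : t ∈ Icc (-a) a := hhs (subset_tsupport _ (Function.mem_support.mpr ht))
      rw [norm_mul, Complex.norm_exp, mul_comm]
      gcongr
      have hre : (c * (t : ℂ)).re = c.re * t := by simp [Complex.mul_re]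
      rw [hre]
      calc c.re * t ≤ |c.re * t| := le_abs_self _
        _ = |c.re| * |t| := abs_mul _ _
        _ ≤ |c.re| * a := by
            gcongr
            exact abs_le.mpr ⟨by linarith [htI.1], htI.2⟩
  have hi : Integrable (fun t : ℝ ↦ ‖h t‖) := (hcont.norm).integrable_of_hasCompactSupport hc.norm
  calc ‖∫ t : ℝ, h t * cexp (c * t)‖ ≤ ∫ t : ℝ, ‖h t * cexp (c * t)‖ :=
        norm_integral_le_integral_norm _
    _ ≤ ∫ t : ℝ, Real.exp (|c.re| * a) * ‖h t‖ :=
        integral_mono_of_nonneg (Eventually.of_forall fun t ↦ norm_nonneg _) (hi.const_mul _)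
          (Eventually.of_forall hpt)
    _ = Real.exp (|c.re| * a) * ∫ t : ℝ, ‖h t‖ := integral_const_mul _ _

/-! ## Decay of the Mellin–Laplace transform -/

/-- **Decay from smoothness (T8).** For `h ∈ C^n_c(ℝ)` with `tsupport h ⊆ [-a, a]`:
`‖s − ½‖ⁿ · ‖ĥ(s)‖ ≤ e^{|Re(s − ½)|·a} · ∫ ‖h⁽ⁿ⁾‖`. -/
theorem norm_weilMellin_le_of_iteratedDeriv (n : ℕ) {h : ℝ → ℂ} (hh : ContDiff ℝ n h)
    (hc : HasCompactSupport h) {a : ℝ} (hhs : tsupport h ⊆ Icc (-a) a) (s : ℂ) :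
    ‖s - 1 / 2‖ ^ n * ‖weilMellin h s‖
      ≤ Real.exp (|(s - 1 / 2).re| * a) * ∫ t : ℝ, ‖iteratedDeriv n h t‖ := by
  have key := integral_iteratedDeriv_mul_cexp n hh hc (s - 1 / 2)
  have hnorm : ‖s - 1 / 2‖ ^ n * ‖weilMellin h s‖
      = ‖∫ t : ℝ, iteratedDeriv n h t * cexp ((s - 1 / 2) * t)‖ := by
    unfold weilMellin
    rw [key, norm_mul, norm_pow, norm_neg]
  rw [hnorm]
  have hcont : Continuous (iteratedDeriv n h) := hh.continuous_iteratedDeriv n le_rfl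
  have hts : ∀ m : ℕ, tsupport (iteratedDeriv m h) ⊆ tsupport h := by
    intro m
    induction m with
    | zero => simp
    | succ m ih => rw [iteratedDeriv_succ]; exact tsupport_deriv_subset.trans ih
  exact norm_integral_mul_cexp_le hcont (GuthMaynardFourier.hasCompactSupport_iteratedDeriv hc n)
    ((hts n).trans hhs) (s - 1 / 2)

/-- **Decay for Weil tests, every order.** For a Weil test `h` with `tsupport h ⊆ [-a, a]` and
every `n`: `‖s − ½‖ⁿ · ‖ĥ(s)‖ ≤ e^{|Re s − ½|·a} · ∫ ‖h⁽ⁿ⁾‖`.  In the closed critical strip the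
exponential factor is at most `e^{a/2}`; on the critical line it is `1`. -/
theorem norm_weilMellin_le_of_isWeilTest {h : ℝ → ℂ} (hh : IsWeilTest h) {a : ℝ}
    (hhs : tsupport h ⊆ Icc (-a) a) (n : ℕ) (s : ℂ) :
    ‖s - 1 / 2‖ ^ n * ‖weilMellin h s‖
      ≤ Real.exp (|s.re - 1 / 2| * a) * ∫ t : ℝ, ‖iteratedDeriv n h t‖ := by
  have hn : ContDiff ℝ n h := hh.1.of_le (by exact_mod_cast le_top)
  have hre : (s - 1 / 2 : ℂ).re = s.re - 1 / 2 := by simp [Complex.sub_re]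
  simpa [hre] using norm_weilMellin_le_of_iteratedDeriv n hn hh.2 hhs s

/-- **Fourier decay on the critical line.** For a Weil test `h` with `tsupport h ⊆ [-a, a]`,
every `n` and every real `τ ≠ 0`: `‖ĥ(½ + iτ)‖ ≤ ‖h⁽ⁿ⁾‖_{L¹} / |τ|ⁿ`. -/
theorem norm_weilMellin_critical_le {h : ℝ → ℂ} (hh : IsWeilTest h) {a : ℝ}
    (hhs : tsupport h ⊆ Icc (-a) a) (n : ℕ) {τ : ℝ} (hτ : τ ≠ 0) :
    ‖weilMellin h (1 / 2 + τ * I)‖ ≤ (∫ t : ℝ, ‖iteratedDeriv n h t‖) / |τ| ^ n := by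
  have h0 := norm_weilMellin_le_of_isWeilTest hh hhs n (1 / 2 + τ * I)
  have hre : ((1 / 2 : ℂ) + τ * I).re - 1 / 2 = 0 := by simp
  have hnrm : ‖(1 / 2 : ℂ) + τ * I - 1 / 2‖ = |τ| := by
    have : (1 / 2 : ℂ) + τ * I - 1 / 2 = τ * I := by ring
    rw [this, norm_mul, Complex.norm_I, mul_one, Complex.norm_real, Real.norm_eq_abs]
  rw [hre, hnrm] at h0
  simp only [abs_zero, zero_mul, Real.exp_zero, one_mul] at h0
  have hpos : 0 < |τ| ^ n := pow_pos (abs_pos.mpr hτ) n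
  rw [le_div_iff₀ hpos, mul_comm]
  exact h0

end Summit.RiemannHypothesis.RiemannHypothesis.Theorems
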